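import Literature.NumberTheory.EllipticCurves.PAdicLFunctionMinusMult
import Literature.NumberTheory.EllipticCurves.PAdicLFunctionMinusDistributionProofs
import Literature.NumberTheory.EllipticCurves.PAdicBSDSplitMultiplicativeProofs
import HarnessLib

/-!
# The one-term minus measure at `p ∣ N`: the `U_p`-relation for `[·]⁻`, the distribution law of
# `μ⁻_{f,a_p}`, and the constant term of its `ω^i`-branches (proved API of `PAdicLFunctionMinusMult`)

Topic `NumberTheory/EllipticCurves`; namespace `Literature.NumberTheory.EllipticCurves`. Theorems only
(no definition, no named fact, no `sorry`). Companion of `PAdicLFunctionMinusMult` (definitions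
`msdMinusMeasureMult`, `padicLFunctionMinusBranchMult`) — the minus / `p ∣ N` image of
`PAdicLFunctionMinusDistributionProofs` (minus, `p ∤ N`) and of
`PAdicLFunctionNonsplitMultiplicativeExistenceProofs` (plus, `p ∣ N`):

* `cuspCoeff_mul_minusSymbol_of_dvd`, `intCast_mul_ratMinusSymbol_of_dvd` — **the `U_p`-relation
  for the minus symbols**, `a_p [r]⁻ = ∑_{j mod p} [(r + j)/p]⁻` for `p ∣ N` (from the tree theorem
  `cuspCoeff_mul_modularSymbol_of_dvd` at `r` and `−r`; Mazur–Tate–Teitelbaum 1986 §I.4 (4.2) with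
  `ε(p) = 0`);
* `sum_fiber_msdMinusMeasureMult_succ_eq` (+ `_of_coeffField`) — **the distribution law** of
  `μ⁻_{f,α}(a + pⁿℤ_p) = α⁻ⁿ[a/pⁿ]⁻` for `α = a_p(f) ≠ 0`, `p ∣ N` (MTT §I.10 (10.2));
* `constantCoeff_padicLFunctionMinusBranchMult_eq` — **the constant term of the `ω^i`-branch**:
  `L⁻_p(f, α, ω^i, 0) = ∑_{a ∈ (ℤ/p^{e₀})ˣ} μ⁻_{f,α}(a + p^{e₀}ℤ_p) · ω(a)^i` (the Riemann sums are a
  fixed finite sum, by the distribution law; MTT §I.13), verbatim the proof of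
  `constantCoeff_padicLFunctionMinusBranch_eq` with the one-term measure.

The specialisation `L⁻_p(f, a_p, ω^{(p−1)/2}, 0) = a_p⁻¹ ∑_{a mod p}(a/p)[a/p]⁻_f` (Euler's criterion for
`ω`) lives with its consumer in `Summits/BirchSwinnertonDyer/Rank1Residual/Additive/` (it uses the
cell's `legendreMinusSymbolSum`). Motivation: BSD rank-`≤ 1` residual cell `b2b-bsdres`, additive-p4
line V15 (X3/X4 (M)-rows at `p = 3`). HONEST FRAMING: proved vocabulary; no label changes.

## References
* B. Mazur, J. Tate, J. Teitelbaum, Invent. Math. 84 (1986): Ch. I §4 (4.2), §10 (10.1)–(10.2) with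
  `ε(p) = 0`, §13. [MazurTateTeitelbaum1986Invent]
-/

noncomputable section

open scoped MatrixGroups ModularForm

open CongruenceSubgroup Filter Topology Literature.NumberTheory.EllipticCurves.ModularForms

namespace Literature.NumberTheory.EllipticCurves

/-! ### The `U_p`-relation for the minus symbols (`p ∣ N`) -/

section MinusUp

variable {N : ℕ} [NeZero N] (p : ℕ) [NeZero p]

/-- **The `U_p`-relation for the minus symbols**: `a_p minusSymbol(r) = ∑_{j mod p} minusSymbol((r + j)/p)`
for a newform `f ∈ S₂(Γ₀(N))` and a prime `p ∣ N` (from `cuspCoeff_mul_modularSymbol_of_dvd` at `r`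
and `−r`, reflecting the sum at `−r` with `{∞, x + 1} = {∞, x}`; twin of
`cuspCoeff_mul_plusSymbol_of_dvd` and of `cuspCoeff_mul_minusSymbol`, `p ∤ N`).
[cite: MazurTateTeitelbaum1986Invent, §I.4 (4.2)] -/
theorem cuspCoeff_mul_minusSymbol_of_dvd {f : CuspForm (Gamma0 N) 2} (hf : IsNewform0 f)
    (hp : p.Prime) (hpN : p ∣ N) (r : ℚ) :
    cuspCoeff f p * minusSymbol f r = ∑ j : Fin p, minusSymbol f ((r + j) / p) := by
  have h1 := cuspCoeff_mul_modularSymbol_of_dvd p hf hp hpN r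
  have h2 := cuspCoeff_mul_modularSymbol_of_dvd p hf hp hpN (-r)
  have hrefl : ∑ j : Fin p, modularSymbol f ((-r + j) / p) =
      ∑ j : Fin p, modularSymbol f (-((r + j) / p)) := by
    rw [← sum_fin_reflect_of_periodic p (modularSymbol f) (fun x ↦ by
      exact_mod_cast modularSymbol_add_intCast_holds f x 1) (-r)]
    refine Finset.sum_congr rfl fun j _ ↦ ?_
    congr 1
    ring
  rw [hrefl] at h2
  simp only [minusSymbol]
  rw [mul_div_assoc', mul_sub, h1, h2, ← Finset.sum_sub_distrib, Finset.sum_div]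

/-- **The `U_p`-relation for the rational minus symbols** `[r]⁻ = ratMinusSymbol f r`:
`a_p [r]⁻ = ∑_{j mod p} [(r + j)/p]⁻` in `ℚ` for a newform with `a_p(f) = a_p ∈ ℤ`, `p ∣ N`, given the
rationality `([r]⁻ : ℝ) = [r]⁻` (`hrat`; `ratCast_ratMinusSymbol` for rational newforms).
[cite: MazurTateTeitelbaum1986Invent, §I.4 (4.2)] -/
theorem intCast_mul_ratMinusSymbol_of_dvd {f : CuspForm (Gamma0 N) 2} (hf : IsNewform0 f)
    (hp : p.Prime) (hpN : p ∣ N) {ap : ℤ} (hap : cuspCoeff f p = ap)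
    (hrat : ∀ r : ℚ, (ratMinusSymbol f r : ℝ) = normalizedMinusSymbol f r) (r : ℚ) :
    (ap : ℚ) * ratMinusSymbol f r = ∑ j : Fin p, ratMinusSymbol f ((r + j) / p) := by
  have h := cuspCoeff_mul_minusSymbol_of_dvd p hf hp hpN r
  rw [hap] at h
  have him := congr_arg Complex.im h
  rw [show ((ap : ℤ) : ℂ) = ((ap : ℝ) : ℂ) by norm_cast, Complex.im_ofReal_mul, Complex.im_sum] at him
  have hnorm : (ap : ℝ) * normalizedMinusSymbol f r =
      ∑ j : Fin p, normalizedMinusSymbol f ((r + j) / p) := by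
    simp only [normalizedMinusSymbol]
    rw [mul_div_assoc', him, Finset.sum_div]
  apply Rat.cast_injective (α := ℝ)
  push_cast
  simp only [hrat]
  exact hnorm

end MinusUp

/-! ### The distribution law of the one-term minus measure -/

section MinusMultDistribution

variable {N : ℕ} [NeZero N] {p : ℕ} [Fact p.Prime]

/-- **The distribution law of `μ⁻_{f,a_p}` at `p ∣ N`** (MTT §I.10 (10.2), `ε(p) = 0`): for a
newform `f` of level `N`, `p ∣ N`, rational minus symbols (`hrat`), `a_p(f) = a_p ∈ ℤ` non-zero in
`ℚ_p`, `∑_{b ≡ a mod pⁿ} μ⁻(b + pⁿ⁺¹ℤ_p) = μ⁻(a + pⁿℤ_p)` for `μ⁻ = msdMinusMeasureMult f a_p`: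
`∑_j a_p⁻⁽ⁿ⁺¹⁾[(x + j)/p]⁻ = a_p⁻⁽ⁿ⁺¹⁾ · a_p [x]⁻ = a_p⁻ⁿ [x]⁻` by the `U_p`-relation.
[cite: MazurTateTeitelbaum1986Invent, §I.10 Prop. (10.2) with ε(p) = 0] -/
theorem sum_fiber_msdMinusMeasureMult_succ_eq {f : CuspForm (Gamma0 N) 2}
    (hrat : ∀ r : ℚ, (ratMinusSymbol f r : ℝ) = normalizedMinusSymbol f r) (hf : IsNewform0 f)
    (hpN : p ∣ N) {ap : ℤ} (hap : cuspCoeff f p = ap) (hap0 : (ap : ℚ_[p]) ≠ 0)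
    (n : ℕ) (a : ZMod (p ^ n)) :
    ∑ b ∈ Finset.univ.filter (fun b : ZMod (p ^ (n + 1)) ↦
        ZMod.castHom (pow_dvd_pow p n.le_succ) (ZMod (p ^ n)) b = a),
      msdMinusMeasureMult f (ap : ℚ_[p]) (n + 1) b = msdMinusMeasureMult f (ap : ℚ_[p]) n a := by
  classical
  haveI : NeZero p := ⟨(Fact.out : p.Prime).ne_zero⟩
  have hp : p.Prime := Fact.out
  have hp0 : (p : ℚ) ≠ 0 := by exact_mod_cast hp.ne_zero
  have hinj : Function.Injective
      (fun j : Fin p ↦ ((a.val + p ^ n * (j : ℕ) : ℕ) : ZMod (p ^ (n + 1)))) := by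
    intro j j' h
    have hv := congr_arg ZMod.val h
    simp only [val_classLift] at hv
    exact Fin.ext (Nat.eq_of_mul_eq_mul_left (pow_pos hp.pos n) (by omega))
  rw [filter_castHom_eq_image, Finset.sum_image fun j _ j' _ h ↦ hinj h]
  set x : ℚ := (a.val : ℚ) / (p : ℚ) ^ n with hx
  have hA : ∀ j : Fin p, ((a.val + p ^ n * (j : ℕ) : ℕ) : ℚ) / (p : ℚ) ^ (n + 1) = (x + j) / p := by
    intro j
    rw [hx]
    push_cast
    field_simp
    ring
  have hHecke := intCast_mul_ratMinusSymbol_of_dvd p hf hp hpN hap hrat x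
  have hsum : ∑ j : Fin p,
      msdMinusMeasureMult f (ap : ℚ_[p]) (n + 1) ((a.val + p ^ n * (j : ℕ) : ℕ) : ZMod (p ^ (n + 1))) =
      (ap : ℚ_[p])⁻¹ ^ (n + 1) * ((ap : ℚ_[p]) * (ratMinusSymbol f x : ℚ_[p])) := by
    calc _ = ∑ j : Fin p, (ap : ℚ_[p])⁻¹ ^ (n + 1) * (ratMinusSymbol f ((x + j) / p) : ℚ_[p]) := by
          refine Finset.sum_congr rfl fun j _ ↦ ?_
          simp only [msdMinusMeasureMult, val_classLift, hA]
      _ = (ap : ℚ_[p])⁻¹ ^ (n + 1) * ((∑ j : Fin p, ratMinusSymbol f ((x + j) / p) : ℚ) : ℚ_[p]) := by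
          rw [← Finset.mul_sum, Rat.cast_sum]
      _ = _ := by
          rw [← hHecke]
          push_cast
          ring
  rw [hsum]
  simp only [msdMinusMeasureMult]
  rw [← hx, pow_succ]
  field_simp

/-- **The distribution law of `μ⁻_{f,a_p}` at `p ∣ N` for a RATIONAL NEWFORM, unconditionally** (the
rationality input is the tree's `ratCast_ratMinusSymbol`, Manin–Drinfeld).
[cite: MazurTateTeitelbaum1986Invent, §I.10 Prop. (10.2) with ε(p) = 0] -/
theorem sum_fiber_msdMinusMeasureMult_succ_eq_of_coeffField {f : CuspForm (Gamma0 N) 2}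
    (hf : IsNewform0 f) (hQ : coeffField f = ⊥)
    (hpN : p ∣ N) {ap : ℤ} (hap : cuspCoeff f p = ap) (hap0 : (ap : ℚ_[p]) ≠ 0)
    (n : ℕ) (a : ZMod (p ^ n)) :
    ∑ b ∈ Finset.univ.filter (fun b : ZMod (p ^ (n + 1)) ↦
        ZMod.castHom (pow_dvd_pow p n.le_succ) (ZMod (p ^ n)) b = a),
      msdMinusMeasureMult f (ap : ℚ_[p]) (n + 1) b = msdMinusMeasureMult f (ap : ℚ_[p]) n a :=
  sum_fiber_msdMinusMeasureMult_succ_eq (ratCast_ratMinusSymbol f hf hQ) hf hpN hap hap0 n a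

end MinusMultDistribution

/-! ### The constant term of the `ω^i`-branches of the one-term minus measure -/

section MinusMultConstantTerm

variable {p : ℕ} [Fact p.Prime] {N : ℕ} {f : CuspForm (Gamma0 N) 2} {α : ℚ_[p]}

/-- **The Riemann sums for the constant term of the `ω^i`-branch are a fixed finite sum at level
`p^{e₀}`**: `padicLMinusBranchMultRiemannSum f α i 0 n = ∑_{a ∈ (ℤ/p^{e₀})ˣ} μ⁻(a + p^{e₀}ℤ_p) · ω(a)^i`,
granted the distribution law of `μ⁻ = msdMinusMeasureMult f α` (`hdist`). Verbatim
`padicLMinusBranchRiemannSum_zero_eq` with the one-term measure. [cite: MazurTateTeitelbaum1986Invent, §I.13] -/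
theorem padicLMinusBranchMultRiemannSum_zero_eq
    (hdist : ∀ (n : ℕ) (a : ZMod (p ^ n)),
      ∑ b ∈ Finset.univ.filter (fun b : ZMod (p ^ (n + 1)) ↦
        ZMod.castHom (pow_dvd_pow p n.le_succ) (ZMod (p ^ n)) b = a), msdMinusMeasureMult f α (n + 1) b =
        msdMinusMeasureMult f α n a)
    (i n : ℕ) :
    padicLMinusBranchMultRiemannSum f α i 0 n =
      ∑ a : (ZMod (p ^ cyclotomicExponent p))ˣ,
        msdMinusMeasureMult f α (cyclotomicExponent p) a *
          ((((teichRep p a : rootsOfUnity (torsionOrder p) ℤ_[p]) : ℤ_[p]ˣ) : ℤ_[p]) : ℚ_[p]) ^ i := by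
  classical
  have hle : cyclotomicExponent p ≤ n + cyclotomicExponent p := Nat.le_add_left _ _
  have he : 1 ≤ cyclotomicExponent p := Nat.pos_of_ne_zero (cyclotomicExponent_ne_zero p)
  set G : ZMod (p ^ (n + cyclotomicExponent p)) → ℚ_[p] := fun u ↦
    RingHom.id ℚ_[p] (msdMinusMeasureMult f α (n + cyclotomicExponent p) u) *
      teichWeight p i (ZMod.castHom (pow_dvd_pow p hle) (ZMod (p ^ cyclotomicExponent p)) u) with hG
  have h1 : padicLMinusBranchMultRiemannSum f α i 0 n =
      ∑ᶠ ζ : rootsOfUnity (torsionOrder p) ℤ_[p], ∑ s : ZMod (p ^ n),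
        G (PadicInt.toZModPow (n + cyclotomicExponent p) ((ζ : ℤ_[p]ˣ) : ℤ_[p]) *
          (cyclotomicGenerator p : ZMod (p ^ (n + cyclotomicExponent p))) ^ s.val) := by
    unfold padicLMinusBranchMultRiemannSum
    refine finsum_congr fun ζ ↦ Finset.sum_congr rfl fun s _ ↦ ?_
    rw [hG]
    dsimp only
    rw [RingHom.id_apply, teichWeight_classMap p i n ζ s, Nat.choose_zero_right, Nat.cast_one,
      mul_one, mul_comm]
  rw [h1, finsum_sum_classes_eq_sum_units p n G]
  have h2 := sum_units_mul_of_distribution (μ := msdMinusMeasureMult f α) hdist (RingHom.id ℚ_[p]) he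
    hle (teichWeight p i)
  rw [hG]
  dsimp only
  rw [h2]
  refine Finset.sum_congr rfl fun a _ ↦ ?_
  rw [RingHom.id_apply, teichWeight_units]

/-- **The constant term of the `ω^i`-branch of the one-term minus measure**:
`padicLMinusBranchMultCoeff f α i 0 = ∑_{a ∈ (ℤ/p^{e₀})ˣ} μ⁻(a + p^{e₀}ℤ_p) · ω(a)^i` (the Riemann
sums are constant in `n`). [cite: MazurTateTeitelbaum1986Invent, §I.13] -/
theorem padicLMinusBranchMultCoeff_zero_eq
    (hdist : ∀ (n : ℕ) (a : ZMod (p ^ n)),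
      ∑ b ∈ Finset.univ.filter (fun b : ZMod (p ^ (n + 1)) ↦
        ZMod.castHom (pow_dvd_pow p n.le_succ) (ZMod (p ^ n)) b = a), msdMinusMeasureMult f α (n + 1) b =
        msdMinusMeasureMult f α n a)
    (i : ℕ) :
    padicLMinusBranchMultCoeff f α i 0 =
      ∑ a : (ZMod (p ^ cyclotomicExponent p))ˣ,
        msdMinusMeasureMult f α (cyclotomicExponent p) a *
          ((((teichRep p a : rootsOfUnity (torsionOrder p) ℤ_[p]) : ℤ_[p]ˣ) : ℤ_[p]) : ℚ_[p]) ^ i := by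
  unfold padicLMinusBranchMultCoeff
  exact (tendsto_const_nhds.congr fun n ↦
    (padicLMinusBranchMultRiemannSum_zero_eq hdist i n).symm).limUnder_eq

/-- **The constant term of `L⁻_p(f, α, ω^i, T)` at `p ∣ N` as a power series**:
`constantCoeff (padicLFunctionMinusBranchMult f α i) = ∑_{a ∈ (ℤ/p^{e₀})ˣ} μ⁻(a + p^{e₀}ℤ_p) ω(a)^i`.
[cite: MazurTateTeitelbaum1986Invent, §I.13] -/
theorem constantCoeff_padicLFunctionMinusBranchMult_eq
    (hdist : ∀ (n : ℕ) (a : ZMod (p ^ n)),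
      ∑ b ∈ Finset.univ.filter (fun b : ZMod (p ^ (n + 1)) ↦
        ZMod.castHom (pow_dvd_pow p n.le_succ) (ZMod (p ^ n)) b = a), msdMinusMeasureMult f α (n + 1) b =
        msdMinusMeasureMult f α n a)
    (i : ℕ) :
    PowerSeries.constantCoeff (padicLFunctionMinusBranchMult f α i) =
      ∑ a : (ZMod (p ^ cyclotomicExponent p))ˣ,
        msdMinusMeasureMult f α (cyclotomicExponent p) a *
          ((((teichRep p a : rootsOfUnity (torsionOrder p) ℤ_[p]) : ℤ_[p]ˣ) : ℤ_[p]) : ℚ_[p]) ^ i := by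
  rw [constantCoeff_padicLFunctionMinusBranchMult, padicLMinusBranchMultCoeff_zero_eq hdist]

end MinusMultConstantTerm

end Literature.NumberTheory.EllipticCurves

end
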